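import Summits.QuantumFields.YangMills.Theorems.UnitScaleTiltProp7CornerCombCellTheoremMember
import Summits.QuantumFields.YangMills.Theorems.UnitScaleTiltProp7CornerCombGaugeRowInhabited
import HarnessLib

/-!
# Route `UnitScaleTilt`, crux K1 «MinimiserStabilityRegPr» (stmt-QuantumFields-19200), route-R E′ (A′)-on-Σ, P-A2 (β), row «(n3)-comb» `hMcomb` —
# lane (II) file F-8b-5b-2 «THE CLOSED CELL THEOREM»: w5-19200 g8's F-8b-4 v2 ★★★`sum_cell_normSq_tild_le_two_slot` WITH ITS DISPLAYED GAUGE ROW `hrow` DISCHARGED by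
# ★routeR-w6 g9's F-8b-5b-1 ★★★`gauge_row_inhabited` — the comb tower's level mass over a period cell in two slots, for the member's matrix tower, no displayed row left.

«(O2) groundwork — route-internal row (n3)-comb, NOT N06, NOT a print row; OPEN» (★★OWNER `ym3-torus-plan` RULINGS №19 O4 ∕ №22 (c) «(II) GO»; MASTER `DESIGN-N3COMB-LINEAR-CORE`
6efb31c3; ★routeR-w1 g9∕g10 PENS ROUND 5 + SPEC F-8; pen-namer word 2026-08-29 12:18:49Z + ★routeR-w6 g9 SPLIT 12:19:23Z «5b-1 = routeR-w6, 5b-2 = w3-19200 g14»).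
Cell `ym3-torus`, width seat `ym-ust-19200-w3` (gen 14).  THEOREMS ONLY (0 `def`, 0 `sorry`); `--kind proof --supports stmt-QuantumFields-19200 --as helper`; count-neutral.
YM₃ on T³ is a ladder rung (R3) — NOT d = 4, NOT infinite volume, NOT a mass gap, NOT the Clay problem; nothing here claims `hMcomb`, `hMcomb₂`, (β), `hPA2`, the stub, the crux.

THE POINT.  F-8b-4 v2 (`…CornerCombCellTheoremMember`) proves, for `N′Lᵏ`-periodic unitary data `U₀ U₁` on `ℤᵈ`, the two-slot bound
`Σ_{t,κ} ‖Ũˡ(boxVec (N′L^{k−l}) t, κ) − 1‖² ≤ 2·A²·(ρˡ)² + 2·B²·((ρ⁻¹)ˡ)²` (`l ≤ k`) from the level windows, the geometric rows and ONE displayed hypothesis: the scalar gauge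
row `hrow : λ_j² ≤ Σ_{i<j} (ρ⁻¹)^{j−i}·(wG·g_i² + wN·n_i² + wM_i·(m_i²+n_i²) + wS·σ_i²·(m_i+n_i+λ_i)²)`.  F-8b-5b-1 (`…CornerCombGaugeRowInhabited`) PROVES that row for the
matrix tower `Ūʲ = avgIter L U₀ j` from ✓F-6d-3′ (Σ over corners, window-restricted — w3-19200 g13's 3a∕3b∕3c∕3d per-corner chain + the g14 splice) ∘ ✓F-8b-5a (the gauge-row
kernel) ∘ ✓F-8b-2 v2 (the lines inhabited), GIVEN the cube letters `L² + L ≤ nC + 1 ≤ AC·L²`, `√L = ρ⁻¹` and four DOMINATIONS of the free weights `wG wN wM wS` by F-8b-5a's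
closed kernel coefficients.  THIS FILE is the one-`exact` composition: F-8b-4 v2's binder list at `Matrix (Fin N) (Fin N) ℂ := Matrix (Fin N) (Fin N) ℂ` with `hL : 2 ≤ L`, MINUS `hrow`, PLUS
F-8b-5b-1's extras (`nC AC hnC hnA hρs hdomG hdomN hdomM hdomS`, verbatim, in the slot where `hrow` stood); conclusion byte-identical to F-8b-4 v2's.  The consumer
(★routeR-w1 g10's F-8c-final-2 knit `hMcomb_holds`) instantiates the letters `m n g y lam` by `fun j => Real.sqrt …`∕`fun _ => rfl`, CHOOSES the weights at the dominations
(`wG := 2Γc`, `wN := 8dΓc`, `wS := 2Δc`, `wM i := 2Μc i + 4Δc·(210(2d+2)L)²α_i²(2d)`) and discharges F-8b-4's smallness∕choice rows by ✓F-8c-final-1a∕1b.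
HONEST SCOPE.  No estimate is proved here — every estimate is in F-8b-4 v2 (w5-19200 g8; ★routeR-w1 g10's `ρ^{2k}` anchor) and F-8b-5b-1 (★routeR-w6 g9); this file only
removes the displayed row.  Rung R3, not Clay; YM gap NOT proved.

References: T. Bałaban, CMP **109** (1987) 249–301 [Balaban1987RG1] ((0.1), (0.4) pp.251–253); CMP **98** (1985) 17–51 [Balaban1985Averaging] ((2) p.17, (42)–(47) pp.23–25,
(68)–(69) p.29, Prop. 3 (122)–(126) pp.35–36); CMP **95** (1984) 17–40 [Balaban1984PropagatorsI] ((1.18)–(1.20) pp.19–20).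
-/

set_option autoImplicit false

noncomputable section

open scoped BigOperators Matrix.Norms.L2Operator

namespace Summit.QuantumFields.YangMills.Theorems.Prop7CornerCombCellTheoremClosed

open Finset
open Literature.MathematicalPhysics.QuantumFieldTheory.Balaban1983to89
open ExpMeanLog (eml)
open B7Prop1Explicit (Site Letter e hol seg boxVec gammaWord plaqWord Wcx Xavg bavg expUnit U1)
open B7Prop2Explicit (avgIter unitaryUnits)
open B7Eq92Concrete (tildIter)
open B7Eq78Linearization (conjR)
open B7Prop3GeneralRotated (tsum)
open B7Prop3GeneralLinear (FhatCov)
open T4TermwiseTorus (IsPeriodic)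
open Summit.QuantumFields.YangMills.Theorems.Prop7CornerCombCellTheoremMember (sum_cell_normSq_tild_le_two_slot)
open Summit.QuantumFields.YangMills.Theorems.Prop7CornerCombGaugeRowInhabited (gauge_row_inhabited)

variable {d N : ℕ} [NeZero N]

/-- ★★★ **THE CLOSED CELL THEOREM — THE COMB TOWER'S LEVEL MASS OVER A PERIOD CELL, TWO SLOTS, NO DISPLAYED ROW** (F-8b-4 v2 ∘ F-8b-5b-1).  Data and letters exactly as in
w5-19200 g8's ✓`Prop7CornerCombCellTheoremMember.sum_cell_normSq_tild_le_two_slot` at the matrix algebra `M_N(ℂ)` (`hL : 2 ≤ L`), with its gauge row `hrow` REPLACED by the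
inputs of ★routeR-w6 g9's ✓`Prop7CornerCombGaugeRowInhabited.gauge_row_inhabited`: the cube letters `nC AC` (`L² + L ≤ nC + 1 ≤ AC·L²`), `√L = ρ⁻¹`, and the four dominations
`hdomG hdomN hdomM hdomS` of the free weights by ✓F-8b-5a's kernel coefficients.  CONCLUSION (byte-identical to F-8b-4 v2's): for every `l ≤ k`,
`Σ_{t,κ} ‖Ũˡ(boxVec (N′L^{k−l}) t, κ) − 1‖² ≤ 2·A²·(ρˡ)² + 2·B²·((ρ⁻¹)ˡ)²` with F-8b-3's closed letters `A`, `B`.  Proof: one `exact`.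
[cite: Balaban1987RG1, (0.1), (0.4) pp.251–253; Balaban1985Averaging, Prop. 3 (122)–(126) pp.35–36, (68)–(69) p.29; Balaban1984PropagatorsI, (1.18)–(1.20) pp.19–20] -/
theorem sum_cell_normSq_tild_le_two_slot_closed (L N' k : ℕ) (hL : 2 ≤ L) (hN' : 0 < N') (U₀ U₁ : Site d → Fin d → (Matrix (Fin N) (Fin N) ℂ)ˣ)
    (hU₀ : IsPeriodic (N' * L ^ k) U₀) (hU₁ : IsPeriodic (N' * L ^ k) U₁)
    (hVu : ∀ j ≤ k, ∀ x μ, avgIter L U₀ j x μ ∈ unitaryUnits (Matrix (Fin N) (Fin N) ℂ)) (hTu : ∀ j < k, ∀ x μ, tildIter L U₀ U₁ j x μ ∈ U1 (Matrix (Fin N) (Fin N) ℂ))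
    (α a μ : ℕ → ℝ) (hα0 : ∀ j, 0 ≤ α j) (hα24 : ∀ j < k, α j ≤ 1 / 24)
    (hα : ∀ j < k, ∀ (z : Site d) (κ : Fin d) (r : Fin d → Fin L), ‖((Wcx L (avgIter L U₀ j) ((L : ℤ) • z) κ (boxVec L r) : (Matrix (Fin N) (Fin N) ℂ)ˣ) : Matrix (Fin N) (Fin N) ℂ) - 1‖ ≤ α j)
    (ha0 : ∀ j, 0 ≤ a j) (hplaq : ∀ j < k, ∀ (x : Site d) (κ' μ' : Fin d), κ' ≠ μ' → ‖((hol (avgIter L U₀ j) x (plaqWord κ' μ') : (Matrix (Fin N) (Fin N) ℂ)ˣ) : Matrix (Fin N) (Fin N) ℂ) - 1‖ ≤ a j)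
    (hμ0 : ∀ j, 0 ≤ μ j) (hμ72 : ∀ j < k, 72 * μ j ≤ 1)
    (Yt : ℕ → Site d → Fin d → Matrix (Fin N) (Fin N) ℂ) (hYt : ∀ (i : ℕ) (x : Site d) (μ' : Fin d), Yt i x μ' = ((tildIter L U₀ U₁ i x μ' : (Matrix (Fin N) (Fin N) ℂ)ˣ) : Matrix
      (Fin N) (Fin N) ℂ) - 1)
    (hμ : ∀ j < k, ∀ (z : Fin d → Fin (N' * L ^ (k - (j + 1)))) (κ : Fin d), (2 * d + 2) * L * Real.sqrt (∑ s : Fin d → Fin L, ∑ ν : Fin d,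
      (‖Yt j ((L : ℤ) • boxVec (N' * L ^ (k - (j + 1))) z + boxVec L s) ν‖ ^ 2
        + ‖Yt j ((L : ℤ) • boxVec (N' * L ^ (k - (j + 1))) z + (L : ℤ) • e κ + boxVec L s) ν‖ ^ 2)) ≤ μ j)
    (Glin Nn rem : ℕ → Site d → Fin d → Matrix (Fin N) (Fin N) ℂ) (Λ : ℕ → Site d → Matrix (Fin N) (Fin N) ℂ)
    (hrem : ∀ (j : ℕ) (z : Site d) (κ : Fin d), rem j z κ = Yt (j + 1) z κ
      - (fderiv ℂ (eml : ((Fin d → Fin L) → Matrix (Fin N) (Fin N) ℂ) → Matrix (Fin N) (Fin N) ℂ) (fun r => ((Wcx L (avgIter L U₀ j) ((L : ℤ) • z) κ (boxVec L r) : (Matrix (Fin N)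
        (Fin N) ℂ)ˣ) : Matrix (Fin N) (Fin N) ℂ))
            (fun r => tsum (avgIter L U₀ j) (Yt j) ((L : ℤ) • z) (gammaWord L κ (boxVec L r) ++ seg κ (-(L : ℤ)))
              * ((Wcx L (avgIter L U₀ j) ((L : ℤ) • z) κ (boxVec L r) : (Matrix (Fin N) (Fin N) ℂ)ˣ) : Matrix (Fin N) (Fin N) ℂ))
            * (((expUnit (Xavg L (avgIter L U₀ j) ((L : ℤ) • z) κ))⁻¹ : (Matrix (Fin N) (Fin N) ℂ)ˣ) : Matrix (Fin N) (Fin N) ℂ)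
          + ((expUnit (Xavg L (avgIter L U₀ j) ((L : ℤ) • z) κ) : (Matrix (Fin N) (Fin N) ℂ)ˣ) : Matrix (Fin N) (Fin N) ℂ) * tsum (avgIter L U₀ j) (Yt j) ((L : ℤ) • z) (seg κ (L : ℤ))
            * (((expUnit (Xavg L (avgIter L U₀ j) ((L : ℤ) • z) κ))⁻¹ : (Matrix (Fin N) (Fin N) ℂ)ˣ) : Matrix (Fin N) (Fin N) ℂ)))
    (hG0 : Glin 0 = Yt 0) (hN0 : Nn 0 = 0) (hΛ0 : ∀ z, Λ 0 z = 0)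
    (hGlin : ∀ (j : ℕ) (z : Site d) (κ : Fin d), Glin (j + 1) z κ
      = (fderiv ℂ (eml : ((Fin d → Fin L) → Matrix (Fin N) (Fin N) ℂ) → Matrix (Fin N) (Fin N) ℂ) (fun r => ((Wcx L (avgIter L U₀ j) ((L : ℤ) • z) κ (boxVec L r) : (Matrix (Fin N)
        (Fin N) ℂ)ˣ) : Matrix (Fin N) (Fin N) ℂ))
            (fun r => tsum (avgIter L U₀ j) (Glin j) ((L : ℤ) • z) (gammaWord L κ (boxVec L r) ++ seg κ (-(L : ℤ)))
              * ((Wcx L (avgIter L U₀ j) ((L : ℤ) • z) κ (boxVec L r) : (Matrix (Fin N) (Fin N) ℂ)ˣ) : Matrix (Fin N) (Fin N) ℂ))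
            * (((expUnit (Xavg L (avgIter L U₀ j) ((L : ℤ) • z) κ))⁻¹ : (Matrix (Fin N) (Fin N) ℂ)ˣ) : Matrix (Fin N) (Fin N) ℂ)
          + ((expUnit (Xavg L (avgIter L U₀ j) ((L : ℤ) • z) κ) : (Matrix (Fin N) (Fin N) ℂ)ˣ) : Matrix (Fin N) (Fin N) ℂ) * tsum (avgIter L U₀ j) (Glin j) ((L : ℤ) • z) (seg κ (L : ℤ))
            * (((expUnit (Xavg L (avgIter L U₀ j) ((L : ℤ) • z) κ))⁻¹ : (Matrix (Fin N) (Fin N) ℂ)ˣ) : Matrix (Fin N) (Fin N) ℂ))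
        - (FhatCov L (avgIter L U₀ j) (Glin j) ((L : ℤ) • z) - conjR (avgIter L U₀ (j + 1) z κ) (FhatCov L (avgIter L U₀ j) (Glin j) ((L : ℤ) • (z + e κ)))))
    (hNn : ∀ (j : ℕ) (z : Site d) (κ : Fin d), Nn (j + 1) z κ
      = (fderiv ℂ (eml : ((Fin d → Fin L) → Matrix (Fin N) (Fin N) ℂ) → Matrix (Fin N) (Fin N) ℂ) (fun r => ((Wcx L (avgIter L U₀ j) ((L : ℤ) • z) κ (boxVec L r) : (Matrix (Fin N)
        (Fin N) ℂ)ˣ) : Matrix (Fin N) (Fin N) ℂ))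
            (fun r => tsum (avgIter L U₀ j) (Nn j) ((L : ℤ) • z) (gammaWord L κ (boxVec L r) ++ seg κ (-(L : ℤ)))
              * ((Wcx L (avgIter L U₀ j) ((L : ℤ) • z) κ (boxVec L r) : (Matrix (Fin N) (Fin N) ℂ)ˣ) : Matrix (Fin N) (Fin N) ℂ))
            * (((expUnit (Xavg L (avgIter L U₀ j) ((L : ℤ) • z) κ))⁻¹ : (Matrix (Fin N) (Fin N) ℂ)ˣ) : Matrix (Fin N) (Fin N) ℂ)
          + ((expUnit (Xavg L (avgIter L U₀ j) ((L : ℤ) • z) κ) : (Matrix (Fin N) (Fin N) ℂ)ˣ) : Matrix (Fin N) (Fin N) ℂ) * tsum (avgIter L U₀ j) (Nn j) ((L : ℤ) • z) (seg κ (L : ℤ))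
            * (((expUnit (Xavg L (avgIter L U₀ j) ((L : ℤ) • z) κ))⁻¹ : (Matrix (Fin N) (Fin N) ℂ)ˣ) : Matrix (Fin N) (Fin N) ℂ))
        - (FhatCov L (avgIter L U₀ j) (Nn j) ((L : ℤ) • z) - conjR (avgIter L U₀ (j + 1) z κ) (FhatCov L (avgIter L U₀ j) (Nn j) ((L : ℤ) • (z + e κ))))
        + rem j z κ)
    (hΛs : ∀ (j : ℕ) (z : Site d), Λ (j + 1) z = FhatCov L (avgIter L U₀ j) (Glin j + Nn j) ((L : ℤ) • z) + Λ j ((L : ℤ) • z))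
    (m n g y lam : ℕ → ℝ)
    (hm : ∀ j, m j = Real.sqrt (∑ t : Fin d → Fin (N' * L ^ (k - j)), ∑ μ' : Fin d, ‖Glin j (boxVec (N' * L ^ (k - j)) t) μ'‖ ^ 2))
    (hn : ∀ j, n j = Real.sqrt (∑ t : Fin d → Fin (N' * L ^ (k - j)), ∑ μ' : Fin d, ‖Nn j (boxVec (N' * L ^ (k - j)) t) μ'‖ ^ 2))
    (hy : ∀ j, y j = Real.sqrt (∑ t : Fin d → Fin (N' * L ^ (k - j)), ∑ μ' : Fin d, ‖Yt j (boxVec (N' * L ^ (k - j)) t) μ'‖ ^ 2))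
    (hg : ∀ j, g j = Real.sqrt (∑ t : Fin d → Fin (N' * L ^ (k - j)), ∑ κ : Fin d, ∑ ν : Fin d,
      ‖conjR (avgIter L U₀ j (boxVec (N' * L ^ (k - j)) t) ν) (Glin j (boxVec (N' * L ^ (k - j)) t + e ν) κ) - Glin j (boxVec (N' * L ^ (k - j)) t) κ‖ ^ 2))
    (hlam : ∀ j, lam j = Real.sqrt (∑ t : Fin d → Fin (N' * L ^ (k - j)), ∑ κ : Fin d,
      ‖Λ j (boxVec (N' * L ^ (k - j)) t) - conjR (avgIter L U₀ j (boxVec (N' * L ^ (k - j)) t) κ) (Λ j (boxVec (N' * L ^ (k - j)) t + e κ))‖ ^ 2))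
    {ρ θ' θg θ₂ ΘM wG wN wS cA cB0 cB1 : ℝ} (hρ0 : 0 < ρ) (hρ1 : ρ < 1)
    (hρm : Real.sqrt ((L : ℝ) ^ 2 * ((L : ℝ) ^ d)⁻¹) = ρ) (hρg : Real.sqrt ((L : ℝ) ^ 4 * ((L : ℝ) ^ d)⁻¹) = ρ⁻¹)
    (hθ' : 0 ≤ θ') (hθg : 0 ≤ θg) (hθ₂ : 0 ≤ θ₂) (hΘM : 0 ≤ ΘM) (hwG : 0 ≤ wG) (hwN : 0 ≤ wN) (hwS : 0 ≤ wS) (hcA : 0 ≤ cA) (hcB0 : 0 ≤ cB0)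
    (hcB1 : 0 ≤ cB1) (wM : ℕ → ℝ) (hwM0 : ∀ j, 0 ≤ wM j) (hwMgeo : ∀ j < k, wM j ≤ ΘM * ρ ^ (4 * (k - j)))
    (hκgeo : ∀ j < k, 210 * ((2 * d + 2) * L) * α j * Real.sqrt (2 * d) ≤ θ' * ρ ^ (4 * (k - j)))
    (hKgeo : ∀ j < k, (24 * α j + 8 * (((d : ℝ) + 2) * L) ^ 2 * a j) * Real.sqrt (d * ((L : ℝ) ^ 2 * ((L : ℝ) ^ d)⁻¹))
      + 210 * ((2 * d + 2) * L) * α j * Real.sqrt (8 * (d : ℝ) ^ 2) ≤ θg * ρ ^ (4 * (k - j)))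
    (hσgeo : ∀ j < k, 260 * μ j * ((2 * d + 2) * L) * Real.sqrt (2 * d) ≤ θ₂ * ρ ^ (2 * (k - j)))
    (nC AC : ℕ) (hnC : L * L + L ≤ nC + 1) (hnA : nC + 1 ≤ AC * (L * L)) (hρs : Real.sqrt (L : ℝ) = ρ⁻¹)
    (hdomG : 2 * (3 * ((Real.sqrt L)⁻¹ * ((d : ℝ) * ((L : ℝ) ^ 2 / 4) * (2 * ((L : ℝ) ^ d)⁻¹ * (L : ℝ) * (L : ℝ)))
              + (L : ℝ)⁻¹ * (2 * (d : ℝ) * (1 - (Real.sqrt L)⁻¹)⁻¹ * ((L : ℝ) ^ 2 / 4) * 2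
                  * (((L : ℝ) ^ d)⁻¹ * (3 * N * ((nC : ℝ) + 1) ^ 2 * ((d : ℝ) * ((d : ℝ) * (AC : ℝ) ^ d)))))
              + (Real.sqrt L)⁻¹ * (2 * (1 - (Real.sqrt L)⁻¹)⁻¹ * 2 * (N / 2 * (d : ℝ) ^ 2 * ((L : ℝ) - 1) ^ 2 * (L : ℝ) ^ 2 * (d : ℝ))))) ≤ wG)
    (hdomN : 8 * (d : ℝ) * (3 * ((Real.sqrt L)⁻¹ * ((d : ℝ) * ((L : ℝ) ^ 2 / 4) * (2 * ((L : ℝ) ^ d)⁻¹ * (L : ℝ) * (L : ℝ)))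
              + (L : ℝ)⁻¹ * (2 * (d : ℝ) * (1 - (Real.sqrt L)⁻¹)⁻¹ * ((L : ℝ) ^ 2 / 4) * 2
                  * (((L : ℝ) ^ d)⁻¹ * (3 * N * ((nC : ℝ) + 1) ^ 2 * ((d : ℝ) * ((d : ℝ) * (AC : ℝ) ^ d)))))
              + (Real.sqrt L)⁻¹ * (2 * (1 - (Real.sqrt L)⁻¹)⁻¹ * 2 * (N / 2 * (d : ℝ) ^ 2 * ((L : ℝ) - 1) ^ 2 * (L : ℝ) ^ 2 * (d : ℝ))))) ≤ wN)
    (hdomM : ∀ i < k, 2 * (3 * ((Real.sqrt L)⁻¹ * ((d : ℝ) * ((L : ℝ) ^ 2 / 4)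
                * (2 * ((L : ℝ) ^ d)⁻¹ * (8 * (((d : ℝ) + 1) * (L : ℝ)) ^ 2 * a i + 8 * α i) ^ 2 * (d : ℝ)))
              + (L : ℝ)⁻¹ * (2 * (d : ℝ) * (1 - (Real.sqrt L)⁻¹)⁻¹ * ((L : ℝ) ^ 2 / 4) * 2
                  * (((L : ℝ) ^ d)⁻¹ * ((12 * N * ((nC : ℝ) + 1) ^ 2 * (d : ℝ) ^ 3 * (nC : ℝ) ^ 2 * a i ^ 2
                      + 3 * (2 * d * L * (4 * α i) + 2 * ((3 * d + 1) * nC : ℝ) ^ 2 * a i) ^ 2) * ((d : ℝ) * ((d : ℝ) * (AC : ℝ) ^ d)))))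
              + (Real.sqrt L)⁻¹ * (2 * (1 - (Real.sqrt L)⁻¹)⁻¹ * 2
                  * ((8 * (d : ℝ) ^ 6 * ((L : ℝ) - 1) ^ 6 + 2 * N * (d : ℝ) ^ 5 * ((L : ℝ) - 1) ^ 4 * (L : ℝ) ^ 2) * a i ^ 2 * (d : ℝ)))))
          + 4 * (3 * ((L : ℝ)⁻¹ * (2 * (d : ℝ) * (1 - (Real.sqrt L)⁻¹)⁻¹ * ((L : ℝ) ^ 2 / 4) * 2 * (3 * ((L : ℝ) ^ 2)⁻¹ * ((L : ℝ) ^ d)⁻¹ * (d : ℝ)))))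
              * ((210 * ((2 * d + 2) * L)) ^ 2 * α i ^ 2 * (2 * d)) ≤ wM i)
    (hdomS : 2 * (3 * ((L : ℝ)⁻¹ * (2 * (d : ℝ) * (1 - (Real.sqrt L)⁻¹)⁻¹ * ((L : ℝ) ^ 2 / 4) * 2 * (3 * ((L : ℝ) ^ 2)⁻¹ * ((L : ℝ) ^ d)⁻¹ * (d : ℝ))))) ≤ wS)
    (hsmall : Real.exp (θ' * (ρ ^ 3 / (1 - ρ ^ 4))) * θ₂ * (1 + cB1) * (ρ ^ 3 / (1 - ρ ^ 4)) ≤ 1 / 2)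
    (hsmallS : 12 * wS * θ₂ ^ 2 * (ρ / (1 - ρ)) ≤ 1 / 2)
    (hcB0sq : 2 * wG * (g 0 + θg * Real.exp (θ' * (ρ ^ 3 / (1 - ρ ^ 4))) * m 0 * ρ ^ (2 * k) * (ρ ^ 3 / (1 - ρ ^ 2))) ^ 2 * (ρ / (1 - ρ)) ≤ cB0 ^ 2)
    (hcB1sq : 2 * (wN * (ρ / (1 - ρ)) + (ΘM + 3 * wS * θ₂ ^ 2) * (ρ ^ 5 / (1 - ρ ^ 5))) ≤ cB1 ^ 2)
    (hcAsq : 2 * ((ΘM + 3 * wS * θ₂ ^ 2) * (Real.exp (θ' * (ρ ^ 3 / (1 - ρ ^ 4))) * m 0) ^ 2) * (ρ / (1 - ρ)) ≤ cA ^ 2) :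
    ∀ l ≤ k, ∑ t : Fin d → Fin (N' * L ^ (k - l)), ∑ κ : Fin d, ‖((tildIter L U₀ U₁ l (boxVec (N' * L ^ (k - l)) t) κ : (Matrix (Fin N) (Fin N) ℂ)ˣ) : Matrix (Fin N) (Fin N) ℂ) - 1‖ ^ 2
      ≤ 2 * ((Real.exp (θ' * (ρ ^ 3 / (1 - ρ ^ 4))) * m 0
              + 2 * Real.exp (θ' * (ρ ^ 3 / (1 - ρ ^ 4))) * θ₂ * (Real.exp (θ' * (ρ ^ 3 / (1 - ρ ^ 4))) * m 0 + cA) * (ρ / (1 - ρ ^ 2))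
              + (cA + cB1 * (2 * Real.exp (θ' * (ρ ^ 3 / (1 - ρ ^ 4))) * θ₂ * (Real.exp (θ' * (ρ ^ 3 / (1 - ρ ^ 4))) * m 0 + cA) * (ρ / (1 - ρ ^ 2))))) ^ 2
            * (ρ ^ l) ^ 2)
        + 2 * ((2 * Real.exp (θ' * (ρ ^ 3 / (1 - ρ ^ 4))) * θ₂ * cB0 * (ρ ^ 3 / (1 - ρ ^ 4))
            + (cB0 + cB1 * (2 * Real.exp (θ' * (ρ ^ 3 / (1 - ρ ^ 4))) * θ₂ * cB0 * (ρ ^ 3 / (1 - ρ ^ 4))))) ^ 2 * ((ρ⁻¹) ^ l) ^ 2) := by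
  -- `M_N(ℂ)` with the operator-norm C⋆ structure of the cell (Mathlib's scoped instances bundled; cf. lit `B10Eq29TubeLine.cstarAlgebraMatrix`);
  -- without this line the F-8b-4 application below does not elaborate (instance search at `𝔸 := Matrix …` exhausts 200 000 heartbeats)
  letI : CStarAlgebra (Matrix (Fin N) (Fin N) ℂ) := {}
  have hL1 : 1 ≤ L := by omega
  -- ★routeR-w6 g9's F-8b-5b-1: the displayed gauge row, inhabited at the tower
  have hrow := gauge_row_inhabited L N' k hL hN' U₀ U₁ hU₀ hU₁ hVu hTu α a μ hα0 hα24 hα ha0 hplaq hμ72 Yt hYt hμ Glin Nn rem Λ hrem hG0 hN0 hΛ0 hGlin hNn hΛs m n g lam hm hn hg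
    hlam hwG hwN wM hwM0 nC AC hnC hnA hρs hdomG hdomN hdomM hdomS
  -- w5-19200 g8's F-8b-4 v2 at the matrix algebra, `hrow` supplied
  exact sum_cell_normSq_tild_le_two_slot L N' k hL1 hN' U₀ U₁ hU₀ hU₁ hVu hTu α a μ hα0 hα24 hα ha0 hplaq hμ0 hμ72 Yt hYt hμ Glin Nn rem Λ hrem hG0 hN0 hΛ0 hGlin hNn hΛs m n g y
    lam hm hn hy hg hlam hρ0 hρ1 hρm hρg hθ' hθg hθ₂ hΘM hwG hwN hwS hcA hcB0 hcB1 wM hwM0 hwMgeo hκgeo hKgeo hσgeo hrow hsmall hsmallS hcB0sq hcB1sq hcAsq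

end Summit.QuantumFields.YangMills.Theorems.Prop7CornerCombCellTheoremClosed

end
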